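import Summits.AtomisticToContinuum.HydrodynamicLimit.Theorems.ImplosionDichotomyHydroLimitProfilewiseBandGuardedWindowClauseS
import Summits.AtomisticToContinuum.HydrodynamicLimit.Theorems.ImplosionDichotomyHydroLimitProfilewiseBandGuardedCubicChannelS
import Summits.AtomisticToContinuum.HydrodynamicLimit.Theorems.ImplosionDichotomyHydroLimitProfilewiseBandGuardedWindowContinuity
import Summits.AtomisticToContinuum.HydrodynamicLimit.Theorems.ImplosionDichotomyHydroLimitProfilewiseBandGuardedLedgerEndD
import Summits.AtomisticToContinuum.HydrodynamicLimit.Theorems.ImplosionDichotomyHydroLimitProfilewiseBandKcwfQReduction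
import Summits.AtomisticToContinuum.HydrodynamicLimit.Theorems.ImplosionDichotomyHydroLimitInBandBandShiftStatics
import Summits.AtomisticToContinuum.HydrodynamicLimit.Theorems.ImplosionDichotomyHydroLimitInBandKineticInstanceOrth
import Summits.AtomisticToContinuum.HydrodynamicLimit.Theorems.ImplosionDichotomyProfilewiseOfInBand
import HarnessLib

/-!
# The in-band clock from the GUARD-RELATIVISED true-law tails — glue (line `IdeatorOneSketch` v19, crux `HydroLimitProfilewiseBand`,
# stmt-AtomisticToContinuum-17372; support file, `--supports` it)

The five plumbing stubs of skeleton v19 are landed (`HydroLimitGuardedSeetTails.stub_energyCurrentTailsG`,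
`HydroLimitGuardedCubicChannelS.stub_cubicChannelRateSG`, `HydroLimitGuardedWindowClauseS.stub_windowClauseRateSG`,
`HydroLimitGuardedWindowContinuity.stub_windowContinuityInBandG`, `HydroLimitGuardedLedgerEndD.stub_ledgerEndDG`).  This file composes
them with the untouched kinetic / static side of the clock into the three consumers of the true-law tails, now fed with the
GUARD-RELATIVISED items SEET_η / EAT_η / CAT_η (`Theorems.HydroLimitGuardedInputs`, p164114) instead of SEET (stmt-17701) / EAT
(stmt-17703) / CAT (stmt-13734):

* `hydroLimitInBand_of_guardedInputs : SEET_η → KCWF-Q → LCTF → EAT_η → CAT_η → ImplosionDichotomy.HydroLimitInBand` (stmt-9133);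
* `hydroLimitProfilewiseBand_of_guardedInputs : … → ImplosionDichotomy.HydroLimitProfilewiseBand` (stmt-17372; registered sub-goal) —
  the `--glue-by` declaration for splitting this crux onto GUARDED children;
* `hydrodynamicLimit_of_guardedInputs : … → _root_.HydrodynamicLimit` — the guarded twin of the closed dock binder DOCK-Q
  (`ClampedTransferDockQ.clampedTransferDockOfInputsQ_proof`, stmt-18054), i.e. the proof the dock needs after a tenure restate
  CAT → CAT_η / EAT → EAT_η / SEET → SEET_η of route OneFlightGossipEngine;
* (remark, §3) the unguarded item glue of lead c8 (p152902) and DOCK-Q (stmt-18054) factor THROUGH the guarded glue by the weakenings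
  `…Guarded_of_unguarded` — v19 is a weakening of v13–v18 input by input (not re-landed: same statements, dedup);
* `…_of_guardedLeafInputs` — the same with the kinetic item KCWF-Q (stmt-18052) replaced by crux 16659's registered stub KCWUSharpPlus
  (unfolded), by the landed `HydroLimitProfilewiseBandKcwfQ.kcwfQ_of_kcwuSharpPlus` (p152422).

What this certifies for the planners (the re-check asked for in `Cruxes/CollisionActivityTails/RESTATE-SPLIT-REQUEST.md` before the
tenure restate of stmt-13734): the heart applies the true-law tails ONLY along the guarded solution in scope, so the guard-relativised
items suffice for 9133, 17372 and the dock; nothing in the tree consumes the unguarded strength of SEET / EAT / CAT.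
prover-line-stmt-AtomisticToContinuum-17372-c13-0 (lead, line cycle 14).
-/

noncomputable section

open MeasureTheory Filter Set Topology InformationTheory
open scoped ENNReal

namespace Summit.AtomisticToContinuum.HydrodynamicLimit.Theorems.HydroLimitGuardedGlue

open Literature.MathematicalPhysics.KineticTheory Literature.Analysis.FluidPDE Literature.Analysis.FunctionSpaces
open Summit.AtomisticToContinuum.HydrodynamicLimit.Theses
open Summit.AtomisticToContinuum.HydrodynamicLimit.Theorems
open Summit.AtomisticToContinuum.HydrodynamicLimit.Theorems.HydroLimitInBandSignedBand
  (KineticCurrentsLDAlongFamiliesQ BandShiftStatics KineticInstanceOrth kcwf_of_kcwfQ)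
open Summit.AtomisticToContinuum.HydrodynamicLimit.Theorems.HydroLimitProfilewiseBandKcwfQ (kcwfQ_of_kcwuSharpPlus)
open Summit.AtomisticToContinuum.HydrodynamicLimit.Theorems.HydroLimitGuardedInputs

/-! ## §1 The uniform band (stmt-9133) and the conjunct from the guarded inputs -/

/-- **`HydroLimitInBand` (stmt-9133) from the GUARD-RELATIVISED inputs SEET_η, KCWF-Q, LCTF, EAT_η, CAT_η.**  The 9133-v16 / 17372-v18
chain with the five tail-consuming steps replaced by their guarded re-runs: KCWF from KCWF-Q (`kcwf_of_kcwfQ`); ECT_η from SEET_η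
(`stub_energyCurrentTailsG`); the one-window ledger `OneWindowLedgerRateD` by `stub_windowClauseRateSG` over the landed solution-wise window
estimate `ClampedTransferDockRate.stub_windowEstimateRate` (p136014), the guarded signed channel `stub_cubicChannelRateSG`, the landed band
statics (p147261) and KC1-orth (p146924); the guarded window continuity `stub_windowContinuityInBandG`; the guarded Grönwall core by
`stub_ledgerEndDG` with the landed a-priori bound (p109679); reduction (p97252) and dock (p97115) unchanged. [folklore] -/
theorem hydroLimitInBand_of_guardedInputs (hS : SuperExponentialEnergyTailsGuarded) (hQ : KineticCurrentsLDAlongFamiliesQ)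
    (hL : OneFlightGossipEngine.LocalClampedTransferLDAlongFamilies) (hE : EnergyActivityTailsGuarded)
    (hC : CollisionActivityTailsGuarded) : ImplosionDichotomy.HydroLimitInBand := by
  have hK : HydroLimitInBandOfHeart.KineticCurrentsWindowLDFamily := kcwf_of_kcwfQ hQ
  have h₆ : EnergyCurrentTailsGuarded := HydroLimitGuardedSeetTails.stub_energyCurrentTailsG hS
  have hOW : OneWindowLedgerRateD :=
    HydroLimitGuardedWindowClauseS.stub_windowClauseRateSG ClampedTransferDockRate.stub_windowEstimateRate
      HydroLimitGuardedCubicChannelS.stub_cubicChannelRateSG HydroLimitInBandBandShift.stub_bandShiftStatics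
      HydroLimitInBandKineticInstanceOrth.stub_kineticInstanceOrth hQ hS hL hE hK hC h₆
  have hWC : WindowContinuityInBandGuarded := HydroLimitGuardedWindowContinuity.stub_windowContinuityInBandG hC hE h₆
  have hG : HydroLimitInBandOfHeart.GronwallCoreInBand :=
    HydroLimitGuardedLedgerEndD.stub_ledgerEndDG hOW hWC EntropyClockDock.ledgerAprioriBound
  exact hydroLimitInBand_of_relEntropyVanishingInBand (EntropyClockDock.relEntropyVanishingInBand_of_gronwallCoreInBand hG)

/-- **The conjunct `_root_.HydrodynamicLimit` from the guarded inputs** — the guarded twin of DOCK-Q (stmt-18054;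
`_root_.HydrodynamicLimit` and `ImplosionDichotomy.HydroLimitInBand` unfold to the same term). [folklore] -/
theorem hydrodynamicLimit_of_guardedInputs (hS : SuperExponentialEnergyTailsGuarded) (hQ : KineticCurrentsLDAlongFamiliesQ)
    (hL : OneFlightGossipEngine.LocalClampedTransferLDAlongFamilies) (hE : EnergyActivityTailsGuarded)
    (hC : CollisionActivityTailsGuarded) : _root_.HydrodynamicLimit :=
  hydroLimitInBand_of_guardedInputs hS hQ hL hE hC

/-- The same with the ROUTE item KCWF-Q (stmt-18052, `OneFlightGossipEngine.KineticCurrentsLDAlongFamiliesQ`; byte-identical with the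
Theorems def, `HydroLimitProfilewiseBandKcwfQ.kcwfQ_iff_routeItem`). [folklore] -/
theorem hydrodynamicLimit_of_guardedRouteInputs (hS : SuperExponentialEnergyTailsGuarded)
    (hQ : OneFlightGossipEngine.KineticCurrentsLDAlongFamiliesQ)
    (hL : OneFlightGossipEngine.LocalClampedTransferLDAlongFamilies) (hE : EnergyActivityTailsGuarded)
    (hC : CollisionActivityTailsGuarded) : _root_.HydrodynamicLimit :=
  hydroLimitInBand_of_guardedInputs hS (HydroLimitProfilewiseBandKcwfQ.kcwfQ_iff_routeItem.2 hQ) hL hE hC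

/-! ## §2 The crux (stmt-17372) from the guarded inputs — the `--glue-by` declarations -/

/-- registered sub-goal `hydroLimitProfilewiseBand_of_guardedInputs` of line IdeatorOneSketch (v19), crux HydroLimitProfilewiseBand
(stmt-AtomisticToContinuum-17372).  **THIS crux from the GUARD-RELATIVISED inputs SEET_η (⟸ stmt-17701), KCWF-Q (stmt-18052), LCTF
(stmt-17691), EAT_η (⟸ stmt-17703), CAT_η (⟸ stmt-13734)** — `profilewiseOfInBand_proof` (p131525) after `hydroLimitInBand_of_guardedInputs`;
the `--glue-by` declaration for splitting the crux onto guarded children. [folklore] -/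
theorem hydroLimitProfilewiseBand_of_guardedInputs :
    SuperExponentialEnergyTailsGuarded → KineticCurrentsLDAlongFamiliesQ →
      OneFlightGossipEngine.LocalClampedTransferLDAlongFamilies → EnergyActivityTailsGuarded → CollisionActivityTailsGuarded →
      ImplosionDichotomy.HydroLimitProfilewiseBand :=
  fun hS hQ hL hE hC => profilewiseOfInBand_proof (hydroLimitInBand_of_guardedInputs hS hQ hL hE hC)

/-- The same with the kinetic item replaced by crux 16659's registered stub KCWUSharpPlus (unfolded; ⟹ KCWF-Q by the landed
`kcwfQ_of_kcwuSharpPlus`, p152422) — the LEAF-level guarded glue of skeleton v19 (`HydroLimitProfilewiseBand_of` there). [folklore] -/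
theorem hydroLimitProfilewiseBand_of_guardedLeafInputs
    (hKCWU : ∃ η₀ : ℝ, 0 < η₀ ∧ ∀ (Θ U C Λ : ℝ), 1 ≤ Θ → 0 ≤ U → 0 ≤ C → 1 ≤ Λ → ∀ σ : ℝ, 0 < σ →
        ∃ β₀ : ℝ, 0 < β₀ ∧
        ∀ (a θ₀ : T3 → ℝ) (u₀ : T3 → V3), Continuous a → Continuous θ₀ → Continuous u₀ →
        (∀ x, Λ⁻¹ ≤ a x ∧ a x ≤ Λ) → (∀ x, Θ⁻¹ ≤ θ₀ x ∧ θ₀ x ≤ Θ) → (∀ x, ‖u₀ x‖ ≤ U) →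
        σ ^ 3 * (⨆ x, a x) ≤ η₀ * ∫ x, a x →
        ∀ Φ : (N : ℕ) →
          HardSphereFlow (Torus.geometry (Fin 3)) (hsDiameter σ N) (N + 1),
        ∀ (A : T3 → Fin 3 → Fin 3 → ℝ) (b : T3 → V3) (G K : T3 × ℝ → ℝ),
        Continuous A → Continuous b → Continuous G → Continuous K →
        ∀ F : T3 × V3 → ℝ, (∀ y, F y =
          (∑ j : Fin 3, ∑ k : Fin 3, A y.1 j k * ((y.2 - u₀ y.1) j * (y.2 - u₀ y.1) k)) +
            (∑ j : Fin 3, b y.1 j * (y.2 - u₀ y.1) j) * G (y.1, ‖y.2 - u₀ y.1‖ ^ 2) +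
            K (y.1, ‖y.2 - u₀ y.1‖ ^ 2)) →
        (∀ y, |F y| ≤ C * (1 + ‖y.2‖ ^ 2)) →
        (∀ x, ∫ v, F (x, v) * localMaxwellian 1 (θ₀ x) (u₀ x) v = 0) →
        (∀ x (j : Fin 3), ∫ v, F (x, v) * v j * localMaxwellian 1 (θ₀ x) (u₀ x) v = 0) →
        (∀ x, ∫ v, F (x, v) * ‖v‖ ^ 2 * localMaxwellian 1 (θ₀ x) (u₀ x) v = 0) →
        ∀ β : ℝ, |β| ≤ β₀ → ∀ ε : ℝ, 0 < ε → ∃ τ₀ : ℝ, 0 < τ₀ ∧ ∀ τ : ℝ, τ₀ ≤ τ →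
        ∃ N₀ : ℕ, ∀ N : ℕ, N₀ ≤ N →
          ∫⁻ z, ENNReal.ofReal (Real.exp (β * ∑ i : Fin (N + 1),
              (τ * ((N : ℝ) + 1) ^ (-(1 / 3 : ℝ)))⁻¹ *
                ∫ r in (0 : ℝ)..(τ * ((N : ℝ) + 1) ^ (-(1 / 3 : ℝ))), F (((Φ N).flow r z) i)))
            ∂(localGibbsLaw σ a u₀ θ₀ N (Φ N)) ≤
          ENNReal.ofReal (Real.exp (ε * ((N : ℝ) + 1))))
    (hS : SuperExponentialEnergyTailsGuarded) (hL : OneFlightGossipEngine.LocalClampedTransferLDAlongFamilies)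
    (hE : EnergyActivityTailsGuarded) (hC : CollisionActivityTailsGuarded) :
    ImplosionDichotomy.HydroLimitProfilewiseBand :=
  profilewiseOfInBand_proof (hydroLimitInBand_of_guardedInputs hS (kcwfQ_of_kcwuSharpPlus hKCWU) hL hE hC)

/-! ## §3 v13–v18 ⟹ v19
The unguarded item glue of lead c8 (`HydroLimitProfilewiseBandKcwfQGlue.hydroLimitProfilewiseBand_of_itemInputs`, p152902) and the dock
binder DOCK-Q (`ClampedTransferDockQ.clampedTransferDockOfInputsQ_proof`, stmt-18054) factor THROUGH the guarded glue above by the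
weakenings `…Guarded_of_unguarded` (`η₀ := 1`) of the statements file — e.g.
`hydroLimitProfilewiseBand_of_guardedInputs (superExponentialEnergyTailsGuarded_of_unguarded hS) hQ hL (energyActivityTailsGuarded_of_unguarded hE)
(collisionActivityTailsGuarded_of_unguarded hC)`; the gate's dedup lint forbids re-landing those two STATEMENTS with the new proof, so they
are recorded here as a remark only (checked rc 0 in the lead's work file before removal). -/

end Summit.AtomisticToContinuum.HydrodynamicLimit.Theorems.HydroLimitGuardedGlue

end
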